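import Literature.RepresentationTheory.Kovacevic2021.SU21IrreducibleCohomologyTable
import Literature.RepresentationTheory.Kovacevic2021.SU21HodgeTypes
import HarnessLib

/-!
# Hodge types of the `(𝔤,K)`-cohomology of an arbitrary irreducible `K`-type datum for `SU(2,1)`
# (Borel–Wallach VI 4.10 (3) / VII 4.11 (2), datum form)

Continuation of `Literature.RepresentationTheory.Kovacevic2021.SU21IrreducibleCohomologyTable` (an
irreducible datum `𝒟` with some `H^q(𝔤𝔩₃, 𝔨; V) ≠ 0` has the `K`-types and the cohomology table of one of
`U(0)`, `U(0,±6)`, `Z(±3)`, `W(3,0)`; `H¹ ≠ 0` iff the `K`-types are those of `Z(±3)`, `H² ≠ 0` iff they are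
those of `U(0)`, `U(0,±6)` or `W(3,0)`) and `SU21HodgeTypes` (the type `(p,q)` of a relative cochain with
respect to `𝔭 = 𝔭⁺ ⊕ 𝔭⁻ = ⟨E₀₂, E₁₂⟩ ⊕ ⟨E₂₀, E₂₁⟩` is read off the `K`-type set `S`, for ANY datum).

**What is proved** (theorems only).  For an IRREDUCIBLE datum `𝒟` (no longer only for the six constructed
modules of `SU21HodgeTypes` §2):
* `hodgeType_one_of_isIrreducible`: if `H¹(𝔤𝔩₃, 𝔨; V) ≠ 0` then either `S` = the `K`-types of
  `J_{1,0} = Z(3)` and every relative `1`-cochain has type `(1,0)` (vanishes on `𝔭⁻`), or `S` = the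
  `K`-types of `J_{0,1} = Z(-3)` and every relative `1`-cochain has type `(0,1)`;
* `hodgeType_three_of_isIrreducible`: the same dichotomy in degree `3` with types `(2,1)` / `(1,2)`;
* `hodgeType_two_of_isIrreducible`: if `H²(𝔤𝔩₃, 𝔨; V) ≠ 0` then exactly one of: `S = {V_{1,0}}` and every
  relative `2`-cochain is a multiple of the Kähler form `L` (type `(1,1)`, `J_{0,0}`); `S` = the `K`-types of
  `D₂` and every relative `2`-cochain has type `(2,0)`; of `D₀`, type `(0,2)`; of `D₁`, type `(1,1)` and
  primitive.
Since in all these cases `H^q = C^q` (`SU21IrreducibleCohomologyTable` §1–§2), these are the Hodge types of the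
cohomology classes: [BorelWallach2000, VI 4.10 (3) "`D_i` contributes to `H^{i,n-i}`", VII 4.11 (2)] for
`n = 2`, at the level of `K`-type data.

## References

* A. Borel, N. Wallach (2000), II 4.2 (3) p. 40; VI 4.8 (4)–(5), 4.10 (1)–(3), Thm 4.11 pp. 131–133;
  VII 4.11 (2). [BorelWallach2000]
* D. Kovačević, Acta Math. Spalatensia 1 (2021) 105–125, §4 Thm 5. [Kovacevic2021]
-/

noncomputable section

open Module
open Literature.Algebra.Lie Literature.Algebra.Lie.ChevalleyEilenberg

namespace Literature.RepresentationTheory.Kovacevic2021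

-- Mathlib idiom (Mathlib/Algebra/Lie/OfAssociative.lean): commutator brackets on associative algebras; needed for
-- the `𝔤𝔩(3,ℂ)`-module structure on `𝒟.V`, as in every file of this directory.
attribute [local instance 100] LieRing.ofAssociativeRing

namespace SU21Datum

variable (𝒟 : SU21Datum)

/-- **Degree `1`: type `(1,0)` or `(0,1)`.** If `𝒟.V` is irreducible with `H¹(𝔤𝔩₃, 𝔨; V) ≠ 0`, then either
the `K`-types are those of `J_{1,0} = Z(3)` and every relative `1`-cochain vanishes on `𝔭⁻` (so
`f(y) = y₀₂ f(E₀₂) + y₁₂ f(E₁₂)`), or they are those of `J_{0,1} = Z(-3)` and every relative `1`-cochain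
vanishes on `𝔭⁺`. [cite: BorelWallach2000, VI Thm 4.11 (3), VII 4.11 (2)] -/
theorem hodgeType_one_of_isIrreducible [LieModule.IsIrreducible ℂ gl3 𝒟.V]
    (h1 : finrank ℂ (relCohomology ℂ gl3 𝒟.V kSub 1) ≠ 0) :
    (𝒟.S = ladderPlus.S ∧ (∀ f ∈ 𝒟.relCochain 1, f ![E 2 0] = 0 ∧ f ![E 2 1] = 0) ∧
        ∀ f ∈ 𝒟.relCochain 1, ∀ y : gl3, f ![y] = y 0 2 • f ![E 0 2] + y 1 2 • f ![E 1 2]) ∨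
    (𝒟.S = ladderMinus.S ∧ (∀ f ∈ 𝒟.relCochain 1, f ![E 0 2] = 0 ∧ f ![E 1 2] = 0) ∧
        ∀ f ∈ 𝒟.relCochain 1, ∀ y : gl3, f ![y] = y 2 0 • f ![E 2 0] + y 2 1 • f ![E 2 1]) := by
  rcases 𝒟.finrank_relCohomology_one_ne_zero_iff_of_isIrreducible.1 h1 with h | h
  · have h2m3 : ((2 : ℤ), (-3 : ℤ)) ∉ 𝒟.S := by rw [h]; exact six_Ktypes.2.2.2.2.1.2.2
    exact Or.inl ⟨h, fun f hf => one_apply_pMinus_eq_zero h2m3 hf,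
      fun f hf y => one_apply_of_not_mem_minus h2m3 hf y⟩
  · have h23 : ((2 : ℤ), (3 : ℤ)) ∉ 𝒟.S := by rw [h]; exact six_Ktypes.2.2.2.2.2.2.1
    exact Or.inr ⟨h, fun f hf => one_apply_pPlus_eq_zero h23 hf,
      fun f hf y => one_apply_of_not_mem_plus h23 hf y⟩

/-- **Degree `3`: type `(2,1)` or `(1,2)`.** If `𝒟.V` is irreducible with `H³(𝔤𝔩₃, 𝔨; V) ≠ 0`, then either the
`K`-types are those of `J_{1,0}` and every relative `3`-cochain vanishes on the basis triples with two
`𝔭⁻`-entries (type `(2,1)`), or they are those of `J_{0,1}` and every relative `3`-cochain vanishes on the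
triples with two `𝔭⁺`-entries (type `(1,2)`). [cite: BorelWallach2000, VI Thm 4.11 (3), VII 4.11 (2)] -/
theorem hodgeType_three_of_isIrreducible [LieModule.IsIrreducible ℂ gl3 𝒟.V]
    (h3 : finrank ℂ (relCohomology ℂ gl3 𝒟.V kSub 3) ≠ 0) :
    (𝒟.S = ladderPlus.S ∧
        ∀ f ∈ 𝒟.relCochain 3, f ![E 0 2, E 2 0, E 2 1] = 0 ∧ f ![E 1 2, E 2 0, E 2 1] = 0) ∨
    (𝒟.S = ladderMinus.S ∧
        ∀ f ∈ 𝒟.relCochain 3, f ![E 0 2, E 1 2, E 2 1] = 0 ∧ f ![E 0 2, E 1 2, E 2 0] = 0) := by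
  -- `H³ ≠ 0` forces the ladder `K`-types (table), hence `H¹ ≠ 0` is not needed: read the table directly
  rcases 𝒟.table_of_isIrreducible h3 with ⟨-, ht⟩ | ⟨-, ht⟩ | ⟨-, ht⟩ | ⟨h, -⟩ | ⟨h, -⟩ | ⟨-, ht⟩
  · exact absurd (by rw [ht, if_neg (by omega)]) h3
  · exact absurd (by rw [ht, if_neg (by omega)]) h3
  · exact absurd (by rw [ht, if_neg (by omega)]) h3
  · have h2m3 : ((2 : ℤ), (-3 : ℤ)) ∉ 𝒟.S := by rw [h]; exact six_Ktypes.2.2.2.2.1.2.2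
    exact Or.inl ⟨h, fun f hf => three_apply_type12_eq_zero h2m3 hf⟩
  · have h23 : ((2 : ℤ), (3 : ℤ)) ∉ 𝒟.S := by rw [h]; exact six_Ktypes.2.2.2.2.2.2.1
    exact Or.inr ⟨h, fun f hf => three_apply_type21_eq_zero h23 hf⟩
  · exact absurd (by rw [ht, if_neg (by omega)]) h3

/-- **Degree `2`: Kähler line, `(2,0)`, `(0,2)` or primitive `(1,1)`.** If `𝒟.V` is irreducible with
`H²(𝔤𝔩₃, 𝔨; V) ≠ 0`, then exactly one of: the `K`-types are `{V_{1,0}}` (`J_{0,0}`) and every relative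
`2`-cochain is a multiple of the Kähler form `L = E₀₂^* ∧ E₂₀^* + E₁₂^* ∧ E₂₁^*`; the `K`-types are those of
`D₂ = U(0,6)` and every relative `2`-cochain is a multiple of `E₀₂^* ∧ E₁₂^*` (type `(2,0)`); those of
`D₀ = U(0,-6)`, multiples of `E₂₀^* ∧ E₂₁^*` (type `(0,2)`); those of `D₁ = W(3,0)`, type `(1,1)` with no
`(2,0)`, `(0,2)` or `L`-component (primitive).
[cite: BorelWallach2000, VI 4.8 (4), 4.10 (3), Thm 4.11 (2), (3), VII 4.11 (2)] -/
theorem hodgeType_two_of_isIrreducible [LieModule.IsIrreducible ℂ gl3 𝒟.V]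
    (h2 : finrank ℂ (relCohomology ℂ gl3 𝒟.V kSub 2) ≠ 0) :
    (𝒟.S = trivialMod.S ∧ ∀ f ∈ 𝒟.relCochain 2, ∀ y z : gl3,
        f ![y, z] = ((y 0 2 * z 2 0 - y 2 0 * z 0 2) + (y 1 2 * z 2 1 - y 2 1 * z 1 2)) • f ![E 0 2, E 2 0]) ∨
    (𝒟.S = holDS.S ∧ ∀ f ∈ 𝒟.relCochain 2, ∀ y z : gl3,
        f ![y, z] = (y 0 2 * z 1 2 - y 1 2 * z 0 2) • f ![E 0 2, E 1 2]) ∨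
    (𝒟.S = antiholDS.S ∧ ∀ f ∈ 𝒟.relCochain 2, ∀ y z : gl3,
        f ![y, z] = (y 2 0 * z 2 1 - y 2 1 * z 2 0) • f ![E 2 0, E 2 1]) ∨
    (𝒟.S = midDS.S ∧ ∀ f ∈ 𝒟.relCochain 2,
        f ![E 0 2, E 1 2] = 0 ∧ f ![E 2 0, E 2 1] = 0 ∧ f ![E 0 2, E 2 0] + f ![E 1 2, E 2 1] = 0) := by
  rcases 𝒟.finrank_relCohomology_two_ne_zero_iff_of_isIrreducible.1 h2 with h | h | h | h
  · have h16 : ((1 : ℤ), (6 : ℤ)) ∉ 𝒟.S := by rw [h]; exact six_Ktypes₂.1.1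
    have h30 : ((3 : ℤ), (0 : ℤ)) ∉ 𝒟.S := by rw [h]; exact six_Ktypes₂.1.2.1
    have h1m6 : ((1 : ℤ), (-6 : ℤ)) ∉ 𝒟.S := by rw [h]; exact six_Ktypes₂.1.2.2
    exact Or.inl ⟨h, fun f hf y z => two_apply_of_typeL h16 h30 h1m6 hf y z⟩
  · have h10 : ((1 : ℤ), (0 : ℤ)) ∉ 𝒟.S := by rw [h]; exact six_Ktypes.2.1.1
    have h30 : ((3 : ℤ), (0 : ℤ)) ∉ 𝒟.S := by rw [h]; exact six_Ktypes₂.2.1.2.1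
    have h1m6 : ((1 : ℤ), (-6 : ℤ)) ∉ 𝒟.S := by rw [h]; exact six_Ktypes₂.2.1.2.2
    exact Or.inr (Or.inl ⟨h, fun f hf y z => two_apply_of_type20 h30 h10 h1m6 hf y z⟩)
  · have h10 : ((1 : ℤ), (0 : ℤ)) ∉ 𝒟.S := by rw [h]; exact six_Ktypes.2.2.1.1
    have h16 : ((1 : ℤ), (6 : ℤ)) ∉ 𝒟.S := by rw [h]; exact six_Ktypes₂.2.2.1.1
    have h30 : ((3 : ℤ), (0 : ℤ)) ∉ 𝒟.S := by rw [h]; exact six_Ktypes₂.2.2.1.2.1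
    exact Or.inr (Or.inr (Or.inl ⟨h, fun f hf y z => two_apply_of_type02 h30 h10 h16 hf y z⟩))
  · have h10 : ((1 : ℤ), (0 : ℤ)) ∉ 𝒟.S := by rw [h]; exact six_Ktypes.2.2.2.1.1
    have h16 : ((1 : ℤ), (6 : ℤ)) ∉ 𝒟.S := by rw [h]; exact six_Ktypes₂.2.2.2.1.1
    have h1m6 : ((1 : ℤ), (-6 : ℤ)) ∉ 𝒟.S := by rw [h]; exact six_Ktypes₂.2.2.2.1.2.2
    refine Or.inr (Or.inr (Or.inr ⟨h, fun f hf => ⟨two_apply_E02_E12_eq_zero h16 hf,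
      two_apply_E20_E21_eq_zero h1m6 hf, ?_⟩⟩))
    have hL : -f ![E 0 2, E 2 0] - f ![E 1 2, E 2 1] = 0 :=
      eq_zero_of_mem_hwSpace_of_not_mem h10 (apply_L_mem_hwSpace hf)
    rw [← neg_eq_zero, neg_add', ← hL]

end SU21Datum

end Literature.RepresentationTheory.Kovacevic2021
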